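import Mathlib
import Literature.MathematicalPhysics.QuantumLattice.GermMarkov
import HarnessLib

/-!
# Crux `GaussianLimitIsFree` (item stmt-CriticalPhenomena-2601), line `registered` (birth v6):
# conditional expectations of a Gaussian field on region σ-algebras are `L²`-small under small
# correlations (stub `stub_gaussian_condExp_sq_le`)

THEOREM-ONLY helper file for the direct germ-form rigidity proof of stub 3 of the skeleton
`Cruxes/GaussianLimitIsFree/Lines/birth.lean` (v6).  Main result `stub_gaussian_condExp_sq_le`: for
a centred Gaussian law `μ` on `𝒮'(ℝ³)`, a set `U ⊆ ℝ³`, a test function `w` and `η ≥ 0` such that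
`|E[ω(w) ω(f)]| ≤ η ‖ω(f)‖₂` for every test function `f` supported in `U`, every conditional
expectation `μ[ω(w) | m]` on a σ-algebra `m ≤ 𝒜(U) = fieldSigma U` satisfies `∫ μ[ω(w) | m]² ≤ η²`.

Proof (Gaussian regression in finite dimension, then a density argument; Rozanov 1982, Ch. 2 §3.1:
for Gaussian fields conditional expectations are orthogonal projections onto closed linear spans).
* `inner_eval_le_of_finset` — for finitely many `f₁, …, f_k` supported in `U`, project `ω(w)` in
  `L²(μ)` onto the span of the `ω(fᵢ)`: `ω(w) = ω(g) + ω(h)` with `g = ∑ cᵢ fᵢ` (so `tsupport g ⊆ U`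
  and `‖ω(g)‖₂² = E[ω(w) ω(g)] ≤ η ‖ω(g)‖₂`) and `ω(h)` uncorrelated with — hence, by joint
  Gaussianity (Mathlib `HasGaussianLaw.indepFun_of_covariance_eval`), independent of — `(ω(fᵢ))ᵢ`;
  so `E[ω(w) Z] = E[ω(g) Z] ≤ η ‖Z‖₂` for every `Z ∈ L²(σ(ω(f₁), …, ω(f_k)))`.
* `lpMeas_iSup_le_topologicalClosure` — `L²` of the supremum of a directed family of σ-algebras is
  the closure of the union of the `L²` spaces (a function orthogonal to all of them has vanishing
  integrals on a generating π-system, hence vanishes: Dynkin + uniqueness).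
* for `Z = μ[ω(w) | m]`, `m ≤ 𝒜(U)`: `‖Z‖₂² = E[ω(w) Z] ≤ η ‖Z‖₂`.

References: Yu. A. Rozanov, *Markov Random Fields* (Springer 1982), Ch. 2 §3.1 (3.1)–(3.3).
-/

noncomputable section

namespace Summit.CriticalPhenomena.Ising3DConformalLimit.Cruxes.GaussianLimitIsFree.Birth

open MeasureTheory ProbabilityTheory Filter
open scoped SchwartzMap RealInnerProductSpace ENNReal ComplexConjugate
open Literature.MathematicalPhysics.QuantumLattice

/-! ### Part 1 — `L²` bookkeeping and the density lemma -/

section L2Helpers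

variable {Ω : Type*} {m0 : MeasurableSpace Ω} {μ : Measure Ω}

/-- In real `L²(μ)`: `⟪toLp F, V⟫ = ∫ F · V`. [folklore] -/
theorem inner_toLp_eq_integral_mul {F : Ω → ℝ} (hF : MemLp F 2 μ) (V : Lp ℝ 2 μ) :
    ⟪hF.toLp F, V⟫ = ∫ ω, F ω * V ω ∂μ := by
  rw [L2.inner_def]
  refine integral_congr_ae ?_
  filter_upwards [hF.coeFn_toLp] with ω hω
  rw [hω, RCLike.inner_apply, conj_trivial, mul_comm]

/-- In real `L²(μ)`: `⟪toLp F, toLp G⟫ = ∫ F · G`. [folklore] -/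
theorem inner_toLp_toLp_eq_integral_mul {F G : Ω → ℝ} (hF : MemLp F 2 μ) (hG : MemLp G 2 μ) :
    ⟪hF.toLp F, hG.toLp G⟫ = ∫ ω, F ω * G ω ∂μ := by
  rw [inner_toLp_eq_integral_mul]
  refine integral_congr_ae ?_
  filter_upwards [hG.coeFn_toLp] with ω hω
  rw [hω]

/-- In real `L²(μ)`: `‖toLp F‖ = √(∫ F²)`. [folklore] -/
theorem norm_toLp_eq_sqrt_integral_sq {F : Ω → ℝ} (hF : MemLp F 2 μ) :
    ‖hF.toLp F‖ = Real.sqrt (∫ ω, F ω ^ 2 ∂μ) := by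
  rw [norm_eq_sqrt_real_inner, inner_toLp_toLp_eq_integral_mul]
  simp_rw [sq]

/-- **Density lemma.**  For a monotone family of sub-σ-algebras `mF i` of a finite measure space,
`L²` of `⨆ i, mF i` is contained in the closure of `⋃ i, L²(mF i)`: if `V ∈ L²(⨆ i, mF i)` and `V'`
is its component orthogonal to that closure, then `∫_A V' = ⟪1_A, V'⟫ = 0` for `A` in the π-system
`⋃ i, mF i`, hence (Dynkin) for all `A ∈ ⨆ i, mF i`, hence `V' = 0`. [folklore] -/
theorem lpMeas_iSup_le_topologicalClosure [IsFiniteMeasure μ] {ι : Type*} [SemilatticeSup ι]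
    [Nonempty ι] {mF : ι → MeasurableSpace Ω} (hmono : Monotone mF) (hle : ∀ i, mF i ≤ m0) :
    lpMeas ℝ ℝ (⨆ i, mF i) 2 μ ≤ (⨆ i, lpMeas ℝ ℝ (mF i) 2 μ).topologicalClosure := by
  have hsup_le : (⨆ i, mF i) ≤ m0 := iSup_le hle
  have hK_le : (⨆ i, lpMeas ℝ ℝ (mF i) 2 μ).topologicalClosure ≤ lpMeas ℝ ℝ (⨆ i, mF i) 2 μ := by
    refine Submodule.topologicalClosure_minimal _ (iSup_le fun i V hV => ?_) ?_
    · exact mem_lpMeas_iff_aestronglyMeasurable.2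
        ((mem_lpMeas_iff_aestronglyMeasurable.1 hV).mono (le_iSup mF i))
    · exact isClosed_aestronglyMeasurable hsup_le
  intro V hV
  obtain ⟨V', hV'def⟩ : ∃ V' : Lp ℝ 2 μ,
      V' = V - (⨆ i, lpMeas ℝ ℝ (mF i) 2 μ).topologicalClosure.starProjection V := ⟨_, rfl⟩
  have hV'orth : V' ∈ ((⨆ i, lpMeas ℝ ℝ (mF i) 2 μ).topologicalClosure)ᗮ :=
    hV'def ▸ Submodule.sub_starProjection_mem_orthogonal V
  have hV'meas : V' ∈ lpMeas ℝ ℝ (⨆ i, mF i) 2 μ :=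
    hV'def ▸ sub_mem hV (hK_le (Submodule.starProjection_apply_mem _ V))
  have hV'int : Integrable V' μ := (Lp.memLp V').integrable one_le_two
  have hbasic : ∀ (i) (t : Set Ω), MeasurableSet[mF i] t → ∫ x in t, V' x ∂μ = 0 := by
    intro i t ht
    have hmem0 : indicatorConstLp 2 (hle i t ht) (measure_ne_top μ t) (1 : ℝ) ∈
        lpMeas ℝ ℝ (mF i) 2 μ := mem_lpMeas_indicatorConstLp (hle i) ht _
    have hmem : indicatorConstLp 2 (hle i t ht) (measure_ne_top μ t) (1 : ℝ) ∈
        (⨆ i, lpMeas ℝ ℝ (mF i) 2 μ).topologicalClosure :=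
      Submodule.le_topologicalClosure _ (Submodule.mem_iSup_of_mem i hmem0)
    rw [← L2.inner_indicatorConstLp_one (hle i t ht) (measure_ne_top μ t) V']
    exact Submodule.inner_right_of_mem_orthogonal hmem hV'orth
  have hzero : ∀ s, MeasurableSet[⨆ i, mF i] s → ∫ x in s, V' x ∂μ = 0 := by
    intro s hs
    induction s, hs using MeasurableSpace.induction_on_inter
        (MeasurableSpace.generateFrom_iUnion_measurableSet mF).symm
        (isPiSystem_iUnion_of_monotone (fun i => {t | MeasurableSet[mF i] t})
          (fun i => @MeasurableSpace.isPiSystem_measurableSet Ω (mF i))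
          fun i j hij t ht => hmono hij t ht) with
    | empty => simp
    | basic t ht =>
      obtain ⟨i, hti⟩ := Set.mem_iUnion.1 ht
      exact hbasic i t hti
    | compl t htm iht =>
      obtain ⟨i⟩ := ‹Nonempty ι›
      have huniv := hbasic i Set.univ MeasurableSet.univ
      rw [setIntegral_univ] at huniv
      have h := integral_add_compl (hsup_le t htm) hV'int
      rwa [iht, huniv, zero_add] at h
    | iUnion f hdisj hfm ih =>
      rw [integral_iUnion (fun i => hsup_le _ (hfm i)) hdisj hV'int.integrableOn]
      simp [ih]
  have hV'0 : V' = 0 := by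
    rw [Lp.eq_zero_iff_ae_eq_zero]
    exact Lp.ae_eq_zero_of_forall_setIntegral_eq_zero' ℝ hsup_le V' two_ne_zero
      ENNReal.ofNat_ne_top (fun s _ _ => hV'int.integrableOn) (fun s hs _ => hzero s hs)
      (mem_lpMeas_iff_aestronglyMeasurable.1 hV'meas)
  rw [hV'def, sub_eq_zero] at hV'0
  rw [hV'0]
  exact Submodule.starProjection_apply_mem _ V

end L2Helpers

/-! ### Part 2 — Gaussian regression on finitely many evaluations -/

section Field

variable {E : Type*} [NormedAddCommGroup E] [NormedSpace ℝ E]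

/-- Continuous linear images of a Gaussian field configuration are Gaussian vectors
(Mathlib `isGaussian_map_of_measurable` on the weak-* dual). [folklore] -/
theorem hasGaussianLaw_clm_of_isGaussianField {μ : Measure (FieldConfig E)}
    (hμ : IsGaussianField μ) {F : Type*} [NormedAddCommGroup F] [NormedSpace ℝ F]
    [MeasurableSpace F] [BorelSpace F] (L : FieldConfig E →L[ℝ] F) :
    HasGaussianLaw (fun ω : FieldConfig E => L ω) μ := by
  haveI := hμ.1
  exact ⟨isGaussian_map_of_measurable L.continuous.measurable⟩

/-- Evaluations `ω ↦ ω f` of a Gaussian field are square integrable (the evaluation is the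
continuous linear functional `PointwiseConvergenceCLM.evalCLM`). [folklore] -/
theorem memLp_two_eval_of_isGaussianField {μ : Measure (FieldConfig E)} (hμ : IsGaussianField μ)
    (f : 𝓢(E, ℝ)) : MemLp (fun ω : FieldConfig E => ω f) 2 μ :=
  (hasGaussianLaw_clm_of_isGaussianField hμ
    (PointwiseConvergenceCLM.evalCLM (RingHom.id ℝ) ℝ f)).memLp_two

/-- **Gaussian regression bound (finite-dimensional).**  Let `μ` be a centred Gaussian field with
`|E[ω(w) ω(f)]| ≤ η ‖ω(f)‖₂` for all `f` supported in `U`, and let `f₁, …, f_k` (a finset `I`) be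
supported in `U`.  Then `E[ω(w) Z] ≤ η ‖Z‖₂` for every `Z ∈ L²` measurable with respect to
`σ(ω(f₁), …, ω(f_k))`.  Proof: orthogonal projection of `ω(w)` onto `span{ω(fᵢ)}` in `L²(μ)` gives
`ω(w) = ω(g) + ω(h)`, `g = ∑ cᵢ fᵢ`, `‖ω(g)‖₂ ≤ η`, and `ω(h)` is uncorrelated with, hence
independent of, the Gaussian vector `(ω(fᵢ))ᵢ` (Rozanov 1982, Ch. 2 §3.1 (3.3)), so
`E[ω(h) Z] = E[ω(h)] E[Z] = 0`. [cite: Rozanov1982, Ch. 2 §3.1 (3.3)] -/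
theorem inner_eval_le_of_finset {μ : Measure (FieldConfig E)} [IsProbabilityMeasure μ]
    (hμ : IsGaussianField μ) {U : Set E} {w : 𝓢(E, ℝ)} {η : ℝ} (hη : 0 ≤ η)
    (hyp : ∀ f : 𝓢(E, ℝ), tsupport ⇑f ⊆ U →
      |∫ ω, ω w * ω f ∂μ| ≤ η * Real.sqrt (∫ ω, (ω f) ^ 2 ∂μ))
    (I : Finset {f : 𝓢(E, ℝ) // tsupport ⇑f ⊆ U}) (V : Lp ℝ 2 μ)
    (hV : AEStronglyMeasurable[MeasurableSpace.comap
      (fun (ω : FieldConfig E) (f : I) => ω f.1.1) MeasurableSpace.pi] V μ) :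
    ⟪(memLp_two_eval_of_isGaussianField hμ w).toLp (fun ω : FieldConfig E => ω w), V⟫ ≤
      η * ‖V‖ := by
  classical
  have h2 : ∀ f : 𝓢(E, ℝ), MemLp (fun ω : FieldConfig E => ω f) 2 μ :=
    memLp_two_eval_of_isGaussianField hμ
  -- the linear map `f ↦ [ω ↦ ω f] ∈ L²(μ)`
  let Φ : 𝓢(E, ℝ) →ₗ[ℝ] Lp ℝ 2 μ :=
    { toFun := fun f => (h2 f).toLp (fun ω : FieldConfig E => ω f)
      map_add' := fun f g => by
        change (h2 (f + g)).toLp (fun ω : FieldConfig E => ω (f + g)) =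
          (h2 f).toLp (fun ω : FieldConfig E => ω f) + (h2 g).toLp (fun ω : FieldConfig E => ω g)
        rw [← MemLp.toLp_add (h2 f) (h2 g)]
        exact MemLp.toLp_congr _ _ (Eventually.of_forall fun ω => by simp)
      map_smul' := fun c f => by
        change (h2 (c • f)).toLp (fun ω : FieldConfig E => ω (c • f)) =
          c • (h2 f).toLp (fun ω : FieldConfig E => ω f)
        rw [← MemLp.toLp_const_smul c (h2 f)]
        exact MemLp.toLp_congr _ _ (Eventually.of_forall fun ω => by simp) }
  have hΦ : ∀ f, Φ f = (h2 f).toLp (fun ω : FieldConfig E => ω f) := fun f => rfl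
  -- the (finite-dimensional, hence complete) span of the `ω ↦ ω f`, `f ∈ I`
  let N : Submodule ℝ (Lp ℝ 2 μ) := Submodule.span ℝ (Set.range fun f : I => Φ f.1.1)
  haveI : FiniteDimensional ℝ N := FiniteDimensional.span_of_finite ℝ (Set.finite_range _)
  haveI : CompleteSpace N := FiniteDimensional.complete ℝ N
  -- the regression `ω(g)` of `ω(w)` on `N`
  obtain ⟨c, hc⟩ :=
    (Submodule.mem_span_range_iff_exists_fun ℝ).1 (N.starProjection_apply_mem (Φ w))
  obtain ⟨g, hgdef⟩ : ∃ g : 𝓢(E, ℝ),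
      g = ∑ i : I, c i • (i : {f : 𝓢(E, ℝ) // tsupport ⇑f ⊆ U}).1 := ⟨_, rfl⟩
  have hg_supp : tsupport ⇑g ⊆ U := by
    rw [hgdef]
    refine Finset.sum_induction _ (fun g : 𝓢(E, ℝ) => tsupport ⇑g ⊆ U)
      (fun a b ha hb => ?_) ?_ (fun i _ => ?_)
    · have hab : ⇑(a + b) = fun x => a x + b x := rfl
      rw [hab]
      exact (tsupport_add _ _).trans (Set.union_subset ha hb)
    · have h0 : ⇑(0 : 𝓢(E, ℝ)) = 0 := rfl
      rw [h0, tsupport_zero]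
      exact Set.empty_subset _
    · have hci : ⇑(c i • (i : {f : 𝓢(E, ℝ) // tsupport ⇑f ⊆ U}).1) =
          fun x => c i • (i : {f : 𝓢(E, ℝ) // tsupport ⇑f ⊆ U}).1 x := rfl
      rw [hci]
      exact (tsupport_smul_subset_right _ _).trans i.1.2
  have hρ : N.starProjection (Φ w) = Φ g := by
    rw [← hc, hgdef, map_sum]
    simp only [map_smul]
  have hgN : Φ g ∈ N := hρ ▸ N.starProjection_apply_mem (Φ w)
  have horth : Φ (w - g) ∈ Nᗮ := by
    have := N.sub_starProjection_mem_orthogonal (Φ w)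
    rwa [hρ, ← map_sub] at this
  have hdecomp : Φ w = Φ g + Φ (w - g) := by rw [map_sub]; abel
  -- `‖ω(g)‖₂ ≤ η`
  have hg_le : ‖Φ g‖ ≤ η := by
    have h1 : ‖Φ g‖ ^ 2 = ⟪Φ w, Φ g⟫ := by
      rw [hdecomp, inner_add_left, Submodule.inner_left_of_mem_orthogonal hgN horth, add_zero,
        real_inner_self_eq_norm_sq]
    have h3 : ⟪Φ w, Φ g⟫ ≤ η * ‖Φ g‖ := by
      rw [hΦ w, hΦ g, inner_toLp_toLp_eq_integral_mul, norm_toLp_eq_sqrt_integral_sq]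
      exact (le_abs_self _).trans (hyp g hg_supp)
    by_cases h0 : ‖Φ g‖ = 0
    · rw [h0]; exact hη
    · have hpos : 0 < ‖Φ g‖ := lt_of_le_of_ne (norm_nonneg _) (Ne.symm h0)
      have h4 : ‖Φ g‖ * ‖Φ g‖ ≤ η * ‖Φ g‖ := by rw [← sq, h1]; exact h3
      exact le_of_mul_le_mul_right h4 hpos
  -- independence: `E[ω(h) Z] = 0`
  have hind : ⟪Φ (w - g), V⟫ = 0 := by
    obtain ⟨Z, hZm, hVZ⟩ := hV
    have hmI_le : MeasurableSpace.comap (fun (ω : FieldConfig E) (f : I) => ω f.1.1)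
        MeasurableSpace.pi ≤ FieldConfig.instMeasurableSpace :=
      (measurable_pi_lambda (fun (ω : FieldConfig E) (f : I) => ω f.1.1)
        fun f => measurable_eval f.1.1).comap_le
    have hae : (fun ω : FieldConfig E => ω (w - g) * V ω) =ᵐ[μ]
        fun ω : FieldConfig E => ω (w - g) * Z ω := hVZ.mono fun ω hω => by simp only [hω]
    rw [hΦ, inner_toLp_eq_integral_mul, integral_congr_ae hae]
    -- joint Gaussianity of `(ω(h), (ω(fᵢ))ᵢ)`
    let L : FieldConfig E →L[ℝ] (Unit → ℝ) × (I → ℝ) :=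
      (ContinuousLinearMap.pi fun _ : Unit =>
          PointwiseConvergenceCLM.evalCLM (RingHom.id ℝ) ℝ (w - g)).prod
        (ContinuousLinearMap.pi fun f : I =>
          PointwiseConvergenceCLM.evalCLM (RingHom.id ℝ) ℝ f.1.1)
    have hG : HasGaussianLaw
        (fun ω : FieldConfig E => (fun _ : Unit => ω (w - g), fun f : I => ω f.1.1)) μ :=
      hasGaussianLaw_clm_of_isGaussianField hμ L
    have hcov : ∀ (_ : Unit) (f : I),
        cov[fun ω : FieldConfig E => ω (w - g), fun ω : FieldConfig E => ω f.1.1; μ] = 0 := by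
      intro _ f
      rw [covariance_eq_sub (h2 (w - g)) (h2 f.1.1), (hμ.2 (w - g)).2, zero_mul, sub_zero]
      have hfN : Φ f.1.1 ∈ N := Submodule.subset_span ⟨f, rfl⟩
      have := Submodule.inner_left_of_mem_orthogonal hfN horth
      rw [hΦ, hΦ, inner_toLp_toLp_eq_integral_mul] at this
      exact this
    have hind0 := HasGaussianLaw.indepFun_of_covariance_eval
      (X := fun (_ : Unit) (ω : FieldConfig E) => ω (w - g))
      (Y := fun (f : I) (ω : FieldConfig E) => ω f.1.1) hG hcov
    have hind1 : IndepFun (fun ω : FieldConfig E => ω (w - g)) Z μ := by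
      rw [IndepFun_iff_Indep] at hind0 ⊢
      exact indep_of_indep_of_le hind0
        (MeasurableSpace.comap_le_comap_of_eq_comp (fun v : Unit → ℝ => v ())
          (measurable_pi_apply ()) rfl)
        hZm.measurable.comap_le
    rw [hind1.integral_fun_mul_eq_mul_integral (measurable_eval (w - g)).aestronglyMeasurable
        (hZm.mono hmI_le).aestronglyMeasurable, (hμ.2 (w - g)).2, zero_mul]
  -- conclusion
  calc ⟪(memLp_two_eval_of_isGaussianField hμ w).toLp (fun ω : FieldConfig E => ω w), V⟫
      = ⟪Φ w, V⟫ := rfl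
    _ = ⟪Φ g, V⟫ + ⟪Φ (w - g), V⟫ := by rw [hdecomp, inner_add_left]
    _ = ⟪Φ g, V⟫ := by rw [hind, add_zero]
    _ ≤ ‖Φ g‖ * ‖V‖ := real_inner_le_norm _ _
    _ ≤ η * ‖V‖ := by gcongr

/-! ### Part 3 — the `L²` bound on conditional expectations, and the stub -/

/-- **Gaussian conditional expectations on region σ-algebras are `L²`-small under small
correlations** (general real normed space `E`).  For a centred Gaussian law `μ` on `FieldConfig E`,
a set `U`, a test function `w` and `η ≥ 0` with `|E[ω(w) ω(f)]| ≤ η ‖ω(f)‖₂` for every `f` supported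
in `U`: `∫ μ[ω(w) | m]² ≤ η²` for every σ-algebra `m ≤ fieldSigma U`.  Proof: `fieldSigma U` is
below the supremum of the directed family `σ(ω(f) : f ∈ I)`, `I` a finset of test functions
supported in `U`; `Y := μ[ω(w) | m]` lies in `L²(⨆_I σ(ω(f) : f ∈ I))`, which is contained in the
closure of `⋃_I L²(σ(ω(f) : f ∈ I))` (`lpMeas_iSup_le_topologicalClosure`), on which
`E[ω(w) ·] ≤ η ‖·‖₂` by the finite-dimensional Gaussian regression (`inner_eval_le_of_finset`) and
continuity; finally `‖Y‖₂² = E[ω(w) Y] ≤ η ‖Y‖₂` (pull-out property).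
[cite: Rozanov1982, Ch. 2 §3.1 (3.1)–(3.3)] -/
theorem integral_condExp_eval_sq_le {μ : Measure (FieldConfig E)} [IsProbabilityMeasure μ]
    (hμ : IsGaussianField μ) {U : Set E} {w : 𝓢(E, ℝ)} {η : ℝ} (hη : 0 ≤ η)
    (hyp : ∀ f : 𝓢(E, ℝ), tsupport ⇑f ⊆ U →
      |∫ ω, ω w * ω f ∂μ| ≤ η * Real.sqrt (∫ ω, (ω f) ^ 2 ∂μ))
    {m : MeasurableSpace (FieldConfig E)} (hm : m ≤ fieldSigma U) :
    ∫ ω, (μ[(fun ω : FieldConfig E => ω w)|m]) ω ^ 2 ∂μ ≤ η ^ 2 := by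
  -- keep the Borel σ-algebra as THE instance (the bound `m` is a local instance otherwise)
  letI : MeasurableSpace (FieldConfig E) := FieldConfig.instMeasurableSpace
  classical
  -- the directed family of finite-dimensional σ-algebras `σ(ω f : f ∈ I)`
  let mI : Finset {f : 𝓢(E, ℝ) // tsupport ⇑f ⊆ U} → MeasurableSpace (FieldConfig E) :=
    fun I => MeasurableSpace.comap (fun (ω : FieldConfig E) (f : I) => ω f.1.1) MeasurableSpace.pi
  have hmI_le : ∀ I, mI I ≤ FieldConfig.instMeasurableSpace := fun I =>
    (measurable_pi_lambda (fun (ω : FieldConfig E) (f : I) => ω f.1.1)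
      fun f => measurable_eval f.1.1).comap_le
  have hmono : Monotone mI := fun I J hIJ =>
    MeasurableSpace.comap_le_comap_of_eq_comp (fun (v : J → ℝ) (f : I) => v ⟨f.1, hIJ f.2⟩)
      (measurable_pi_lambda _ fun f => measurable_pi_apply _) rfl
  have hFU : fieldSigma U ≤ ⨆ I, mI I := by
    refine iSup_le fun f => le_iSup_of_le {f} ?_
    exact MeasurableSpace.comap_le_comap_of_eq_comp
      (fun v : (({f} : Finset {f : 𝓢(E, ℝ) // tsupport ⇑f ⊆ U}) → ℝ) =>
        v ⟨f, Finset.mem_singleton_self f⟩) (measurable_pi_apply _) rfl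
  have hm0 : m ≤ FieldConfig.instMeasurableSpace := hm.trans (fieldSigma_le U)
  -- `X = ω(w)` and `Y = μ[X | m]`
  have hXw : MemLp (fun ω : FieldConfig E => ω w) 2 μ := memLp_two_eval_of_isGaussianField hμ w
  have hY2 : MemLp (μ[(fun ω : FieldConfig E => ω w)|m]) 2 μ := hXw.condExp one_le_two
  have hYm : StronglyMeasurable[m] (μ[(fun ω : FieldConfig E => ω w)|m]) :=
    stronglyMeasurable_condExp
  -- `∫ Y² = ∫ X Y` (pull-out property)
  have hkey : ∫ ω, (μ[(fun ω : FieldConfig E => ω w)|m]) ω ^ 2 ∂μ =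
      ∫ ω, ω w * (μ[(fun ω : FieldConfig E => ω w)|m]) ω ∂μ := by
    have hprod :
        Integrable ((μ[(fun ω : FieldConfig E => ω w)|m]) * fun ω : FieldConfig E => ω w) μ :=
      hY2.integrable_mul hXw
    have h1 := condExp_mul_of_stronglyMeasurable_left (μ := μ) hYm hprod
      (hXw.integrable one_le_two)
    calc ∫ ω, (μ[(fun ω : FieldConfig E => ω w)|m]) ω ^ 2 ∂μ
        = ∫ ω, ((μ[(fun ω : FieldConfig E => ω w)|m]) *
            μ[(fun ω : FieldConfig E => ω w)|m]) ω ∂μ := by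
          simp only [Pi.mul_apply, sq]
      _ = ∫ ω, (μ[(μ[(fun ω : FieldConfig E => ω w)|m]) * (fun ω : FieldConfig E => ω w)|m]) ω ∂μ :=
          (integral_congr_ae h1).symm
      _ = ∫ ω, ((μ[(fun ω : FieldConfig E => ω w)|m]) * fun ω : FieldConfig E => ω w) ω ∂μ :=
          integral_condExp hm0
      _ = ∫ ω, ω w * (μ[(fun ω : FieldConfig E => ω w)|m]) ω ∂μ := by
          simp only [Pi.mul_apply, mul_comm]
  -- the `L²` class of `Y` lies in the closure of `⋃_I L²(mI I)`
  obtain ⟨V, hVdef⟩ : ∃ V : Lp ℝ 2 μ, V = hY2.toLp (μ[(fun ω : FieldConfig E => ω w)|m]) :=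
    ⟨_, rfl⟩
  have hVmeas : AEStronglyMeasurable[⨆ I, mI I] V μ :=
    ⟨_, hYm.mono (hm.trans hFU), hVdef ▸ hY2.coeFn_toLp⟩
  have hVK : V ∈ (⨆ I, lpMeas ℝ ℝ (mI I) 2 μ).topologicalClosure :=
    lpMeas_iSup_le_topologicalClosure hmono hmI_le (mem_lpMeas_iff_aestronglyMeasurable.2 hVmeas)
  -- the regression bound extends to the closure by continuity
  have hbound : ⟪hXw.toLp _, V⟫ ≤ η * ‖V‖ := by
    have hclosed : IsClosed {Z : Lp ℝ 2 μ | ⟪hXw.toLp _, Z⟫ ≤ η * ‖Z‖} :=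
      isClosed_le (continuous_const.inner continuous_id) (continuous_const.mul continuous_norm)
    have hdir : Directed (· ≤ ·) fun I => lpMeas ℝ ℝ (mI I) 2 μ := by
      refine Monotone.directed_le fun I J hIJ Z hZ => ?_
      exact mem_lpMeas_iff_aestronglyMeasurable.2
        ((mem_lpMeas_iff_aestronglyMeasurable.1 hZ).mono (hmono hIJ))
    have hsub : ((⨆ I, lpMeas ℝ ℝ (mI I) 2 μ : Submodule ℝ (Lp ℝ 2 μ)) : Set (Lp ℝ 2 μ)) ⊆
        {Z : Lp ℝ 2 μ | ⟪hXw.toLp _, Z⟫ ≤ η * ‖Z‖} := by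
      intro Z hZ
      obtain ⟨I, hI⟩ := (Submodule.mem_iSup_of_directed _ hdir).1 hZ
      exact inner_eval_le_of_finset hμ hη hyp I Z (mem_lpMeas_iff_aestronglyMeasurable.1 hI)
    have hVK' : V ∈ ((⨆ I, lpMeas ℝ ℝ (mI I) 2 μ).topologicalClosure : Set (Lp ℝ 2 μ)) := hVK
    rw [Submodule.topologicalClosure_coe] at hVK'
    exact closure_minimal hsub hclosed hVK'
  -- numerics: `‖V‖² = ∫ Y² = ∫ X Y = ⟪X, V⟫ ≤ η ‖V‖`
  have hinner : ⟪hXw.toLp _, V⟫ = ∫ ω, ω w * (μ[(fun ω : FieldConfig E => ω w)|m]) ω ∂μ := by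
    rw [hVdef, inner_toLp_toLp_eq_integral_mul]
  have hnormsq : ‖V‖ ^ 2 = ∫ ω, (μ[(fun ω : FieldConfig E => ω w)|m]) ω ^ 2 ∂μ := by
    rw [hVdef, norm_toLp_eq_sqrt_integral_sq, Real.sq_sqrt (integral_nonneg fun ω => sq_nonneg _)]
  have hle : ‖V‖ ^ 2 ≤ η * ‖V‖ := by rw [hnormsq, hkey, ← hinner]; exact hbound
  have hVle : ‖V‖ ≤ η := by
    by_cases h0 : ‖V‖ = 0
    · rw [h0]; exact hη
    · have hpos : 0 < ‖V‖ := lt_of_le_of_ne (norm_nonneg _) (Ne.symm h0)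
      have h4 : ‖V‖ * ‖V‖ ≤ η * ‖V‖ := by rw [← sq]; exact hle
      exact le_of_mul_le_mul_right h4 hpos
  calc ∫ ω, (μ[(fun ω : FieldConfig E => ω w)|m]) ω ^ 2 ∂μ = ‖V‖ ^ 2 := hnormsq.symm
    _ ≤ η ^ 2 := by gcongr

end Field

/-- **Stub 3.1 (`stub_gaussian_condExp_sq_le`) of the skeleton, `E = ℝ³`: Gaussian conditional
expectations on region σ-algebras are `L²`-small under small correlations** — the special case
`E = EuclideanSpace ℝ (Fin 3)` of `integral_condExp_eval_sq_le` (Gaussian projection theorem in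
quantitative form, Rozanov 1982, Ch. 2 §3.1). [cite: Rozanov1982, Ch. 2 §3.1 (3.1)–(3.3)] -/
theorem stub_gaussian_condExp_sq_le :
    ∀ (μ : MeasureTheory.Measure
        (Literature.MathematicalPhysics.QuantumLattice.FieldConfig (EuclideanSpace ℝ (Fin 3))))
      [MeasureTheory.IsProbabilityMeasure μ],
      Literature.MathematicalPhysics.QuantumLattice.IsGaussianField μ →
      ∀ (U : Set (EuclideanSpace ℝ (Fin 3))) (w : SchwartzMap (EuclideanSpace ℝ (Fin 3)) ℝ)
        (η : ℝ), 0 ≤ η →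
        (∀ f : SchwartzMap (EuclideanSpace ℝ (Fin 3)) ℝ, tsupport ⇑f ⊆ U →
          |∫ ω, ω w * ω f ∂μ| ≤ η * Real.sqrt (∫ ω, (ω f) ^ 2 ∂μ)) →
        ∀ (m : MeasurableSpace
            (Literature.MathematicalPhysics.QuantumLattice.FieldConfig (EuclideanSpace ℝ (Fin 3)))),
          m ≤ Literature.MathematicalPhysics.QuantumLattice.fieldSigma U →
          ∫ ω, (MeasureTheory.condExp m μ (fun ω => ω w)) ω ^ 2 ∂μ ≤ η ^ 2 :=
  fun _ _ hμ _ _ _ hη hyp _ hm => integral_condExp_eval_sq_le hμ hη hyp hm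

end Summit.CriticalPhenomena.Ising3DConformalLimit.Cruxes.GaussianLimitIsFree.Birth

end
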